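import Literature.NumberTheory.EllipticCurves.FineSelmerIsotypicBoundedProofs
import Literature.NumberTheory.EllipticCurves.FineSelmerMuRoadDoorsUnconditional
import Literature.NumberTheory.NumberFields.ClassGroupNormRelations
import Literature.NumberTheory.IwasawaTheory.ClassicalMuVanishesBoundedRankProofs
import Literature.NumberTheory.IwasawaTheory.Fukuda1994Thm1Consequences
import HarnessLib

/-!
# Coates–Sujatha's Conjecture A from the classical `μ`-invariant of ONE TORSION-POINT FIELD: statement (A)
# for `E` at an odd tame prime `p` from `μ_p(K(P)_cyc) = 0` (the torsion-point-field `μ`-road; proved)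

`Proofs`-style file (theorems only: no definition, no named fact, no `sorry`) in topic
`NumberTheory/EllipticCurves`, written by the literature seat `bsd-potss-conjA-anchor` g19 (cell `bsd-potss`;
serves the asides stmt-BirchSwinnertonDyer-19386 / 19413; closes nothing; (A) / BSD is proved for no
particular curve here).  Namespaces: `Literature.NumberTheory.EllipticCurves.FineSelmerStabilizerDescent`
(§1–§3, the descent lemmas) and `…EllipticCurves.CoatesSujatha2005` (§4, the criteria).

THE THEOREM (`CoatesSujatha2005.conjA_of_classicalMuVanishes_stabilizerField`).  `K` a number field,
`E = W/K` elliptic, `p` an odd prime with `E[p]` IRREDUCIBLE and TAME (`p ∤ #Gal(K(E[p])/K)`), `P ∈ E[p] ∖ 0`,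
`K(P) = K̄^{Stab(P)}` its field of definition.  IF the classical Iwasawa `μ`-invariant of the cyclotomic
`ℤ_p`-extension of `K(P)` vanishes (`IwasawaTheory.ClassicalMuVanishes`, growth form, for every — equivalently
one — cyclotomic `ℤ_p`-extension of `K(P)`), THEN statement (A) of Coates–Sujatha holds for `E` at `p`: the
Pontryagin dual of the fine Selmer group `Sel₀(E/K_∞)[p^∞]` is finitely generated over `ℤ_p`
(`∃ γ D, Module.Finite ℤ_[p] D.X`, the tree's spelling).  Bounded-rank form:
`fineSelmerDual_moduleFinite_of_classGroupPRank_stabilizerField_le` (`rank_p Cl(K(P)_m) ≤ B` for all `m`).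

This sharpens Coates–Sujatha 2005 Thm. 3.4 («`μ_p(K(E[p])_cyc) = 0 ⟹` (A)», tree
`fineSelmerDual_moduleFinite_of_forall_classGroupPRank_le`, seat k8t-c4 g21/g22) from the division field
`K(E[p])` (degree up to `#GL₂(𝔽_p)`) to the torsion-point field `K(P)` (degree `#(orbit of P) ≤ p² − 1`:
`8` for the normaliser-of-non-split-Cartan rows at `p = 3`, `24` at `p = 5`), and it is the `λ`-TOLERANT
form of Deo–Ray–Sujatha 2023 Thm. 3.9 (b) / Lemma 5.1 («`p ∤ h(ℚ(P))` + (c1) + (c3) ⟹ (A)», tree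
`DeoRaySujatha2023.thm39_of_homTrivial_of_eigenHom_stabilizerField`): no hypothesis at the primes above
`p`, none at the bad primes, and `p` MAY divide `h(K(P))` — only the `μ`-invariant of `K(P)` must vanish.
It is the kernel form of the sentence «for `H = Stab(P)`, `p ∤ #H`, restriction embeds
`X_nr(L_∞)^H ↪ X_nr(K(P)_∞)` and `ρ̄^H ∋ P ≠ 0`, so already `μ_p(K(P)) = 0` gives K1» of
`Summits/BirchSwinnertonDyer/Rank1Residual/SmallImageMu/TorsionPointFieldMu.lean` (there a provenance remark;
K1 = the isotypic unramified `μ`; here K1 ⟹ (A) is PROVED, the Selmer-`μ` part K2 is not touched).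

Proof.  By the cell's isotypic bounded-multiplicity criterion
(`CoatesSujatha2005.fineSelmerDual_moduleFinite_of_card_equivariantHom_le`, sibling
`FineSelmerIsotypicBoundedProofs`) it suffices to bound, uniformly in `n`, the number of
`Gal(K̄/K_n)`-equivariant additive maps `μ : Cl(L_n) → E[p]`, `L_n = K(E[p])·K_n`.  §2: for `Γ₀ = Gal(K̄/K_n)`,
`H = H_{P,n} ≤ Gal(L_n/K)` the image of `Stab(P) ∩ Γ₀` and `F_n = L_n^{H}` (`= K(P)·K_n`), the restriction
`μ ↦ μ ∘ i_{L_n/F_n}` is INJECTIVE on such maps: `μ(i(N c)) = ∑_{h ∈ H} h̃ • μ(c)` (Neukirch III (1.6)(iv) on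
classes), the averaging operator `T = ∑_{h ∈ H} h̃` has `T(P) = #H · P ≠ 0` (`p ∤ #H`, as `H ↪ Gal(K(E[p])/K)`),
and `{v : T(δ v) = 0 ∀ δ ∈ Γ₀}` is a `Γ₀`-stable subgroup containing `μ(Cl(L_n))` and not `P`, hence `0` by
irreducibility — under `Γ₀`, which follows from irreducibility under `Γ_K` because `Γ_K = Γ₀ · Gal(K̄/K(E[p]))`
(`[Γ_K : Γ₀] = pⁿ` is prime to `#Gal(K(E[p])/K)`, §3).  So the count is `≤ #Hom(Cl(F_n), E[p]) ≤
#E[p]^{[Cl(F_n) : Cl(F_n)^p]}` (§1), and `F_n ≅` the appropriate layer of the (shifted) cyclotomic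
`ℤ_p`-extension of `K(P)` (§3, Krull correspondence + `ZpExtension.exists_zpExtension_shift`), whose
`[Cl : Cl^p] = p^{rank_p}` is bounded by hypothesis (`μ = 0 ⟹` bounded ranks:
`IwasawaTheory.exists_forall_classGroupPRank_le_of_classicalMuVanishes`, seat k8t-c4 g22).

* §1 `natCard_addMonoidHom_le_pow_index` (`#Hom(A, V) ≤ #V^{[A : A^q]}`).
* §2 `equivariantHom_eq_zero_of_comp_classGroupExtend_fixedField_eq_zero`,
  `natCard_equivariantHom_le_natCard_hom_fixedField` — the injectivity of `μ ↦ μ ∘ i_{L/L^{H_P}}`.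
* §3 `fixedField_inf_layerSubgroup_eq_fixedField_sup_layer` (`K̄^{U ∩ κ⁻¹(pⁿℤ_p)} = K̄^U ⊔ K_n`),
  `lift_fixedField_map_absRestrictNormalHom_eq` (`L^{res(U)} = K̄^U` for `Gal(K̄/L) ≤ U`),
  `natCard_map_absRestrictNormalHom_dvd_card_aut_divisionField` (`#H_{P,n} ∣ #Gal(K(E[p])/K)`),
  `irreducible_layerSubgroup_of_not_dvd_card_aut_divisionField` (`Γ_K`-irreducible + tame ⟹ `Gal(K̄/K_n)`-irreducible).
* §4 `fineSelmerDual_moduleFinite_of_index_stabilizer_layer_le` (bounded `[Cl(F_n) : Cl(F_n)^p]` ⟹ (A)),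
  `fineSelmerDual_moduleFinite_of_classGroupPRank_stabilizerField_le` (bounded `rank_p Cl(K(P)_m)` ⟹ (A)),
  `conjA_of_classicalMuVanishes_stabilizerField` (`μ_p(K(P)_cyc) = 0 ⟹` (A)).
* §5 Numeric doors at `K(P)` (the sibling `FineSelmerMuRoadDoorsUnconditional`'s Doors 1–3 moved from `K(E[p])` to
  `K(P)`): `conjA_of_not_dvd_classNumber_stabilizerField_of_unique_prime` (Iwasawa 1956: `p ∤ h(K(P))`, one prime
  of `K(P)` above `p`), `conjA_of_classNumberPExp_stabilizerField_succ_eq` (Fukuda Thm. 1 (1)),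
  `conjA_of_classGroupPRank_stabilizerField_succ_eq` (Fukuda Thm. 1 (2): `rank_p Cl(K(P)_{n+1}) = rank_p Cl(K(P)_n)`).

References: [CoatesSujatha2005] J. Coates, R. Sujatha, *Fine Selmer groups of elliptic curves over `p`-adic Lie
extensions*, Math. Ann. 331 (2005) 809–839, §3 Lemma 3.8, Thm. 3.4; [DeoRaySujatha2023] S. V. Deo, A. Ray,
R. Sujatha, *On the μ equals zero conjecture for fine Selmer groups in Iwasawa theory*, Pure Appl. Math. Q. 19
(2023), §3 Thm. 3.8/3.9, §5 Lemma 5.1 (arXiv:2202.09937); [Lim2017FineSelmer] M. F. Lim, *Notes on the fine Selmer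
groups*, Asian J. Math. 21 (2017), §3; [NeukirchANT1999] Ch. III §1 Prop. (1.6) (iv), Ch. IV §1; [Washington1997]
§10.2, §13.1, §13.3.
-/

set_option autoImplicit false

noncomputable section

open scoped Classical Pointwise NumberField
open NumberField IsDedekindDomain Field IntermediateField

namespace Literature.NumberTheory.EllipticCurves.FineSelmerStabilizerDescent

open Literature.NumberTheory.GaloisRepresentations Literature.NumberTheory.NumberFields
  Literature.NumberTheory.EllipticCurves Literature.NumberTheory.EllipticCurves.ZpExtension
  Literature.NumberTheory.IwasawaTheory.EquivariantUnramifiedHomsZpTowerFinite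

/-! ## §1 Two counting lemmas -/

/-- An element killed by two coprime natural numbers is zero. [folklore] -/
private theorem eq_zero_of_nsmul_eq_zero_of_coprime {M : Type*} [AddMonoid M] {a b : ℕ}
    (hab : a.Coprime b) {x : M} (ha : a • x = 0) (hb : b • x = 0) : x = 0 := by
  have hord : addOrderOf x ∣ 1 := by
    rw [← hab]
    exact Nat.dvd_gcd (addOrderOf_dvd_of_nsmul_eq_zero ha) (addOrderOf_dvd_of_nsmul_eq_zero hb)
  exact AddMonoid.addOrderOf_eq_one_iff.mp (Nat.dvd_one.mp hord)

/-- **`#Hom(A, V) ≤ #V ^ [A : A^q]`** for a finite abelian group `A` and a `q`-torsion abelian group `V`: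
an additive map `A → V` kills `A^q`, so it is determined by its values on representatives of `A/A^q`.
[cite: Washington1997, §10.2 (the `p`-rank of a finite abelian group; `Hom(A, ℤ/p) ≅ A/A^p`)] -/
theorem natCard_addMonoidHom_le_pow_index {A : Type*} [CommGroup A] [Finite A] {V : Type*}
    [AddCommGroup V] [Finite V] {q : ℕ} (hqV : ∀ v : V, q • v = 0) :
    Nat.card (Additive A →+ V) ≤ Nat.card V ^ (powMonoidHom q : A →* A).range.index := by
  set H : Subgroup A := (powMonoidHom q : A →* A).range with hH
  let Φ : (Additive A →+ V) → (A ⧸ H → V) := fun μ x => μ (Additive.ofMul x.out)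
  have hΦ : ∀ (μ : Additive A →+ V) (x : A ⧸ H), Φ μ x = μ (Additive.ofMul x.out) := fun _ _ => rfl
  have hkill : ∀ (ν : Additive A →+ V) (k : H), ν (Additive.ofMul (k : A)) = 0 := by
    intro ν k
    obtain ⟨b, hb⟩ := k.2
    rw [← hb, powMonoidHom_apply, ofMul_pow, map_nsmul, hqV]
  have key : ∀ (ν : Additive A →+ V) (a : Additive A), Φ ν (↑(Additive.toMul a)) = ν a := by
    intro ν a
    obtain ⟨k, hk⟩ := QuotientGroup.mk_out_eq_mul H (Additive.toMul a)
    rw [hΦ, hk, ofMul_mul, map_add, hkill, add_zero, ofMul_toMul]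
  have hinj : Function.Injective Φ := by
    intro μ μ' h
    refine AddMonoidHom.ext fun a => ?_
    rw [← key μ, ← key μ', h]
  calc Nat.card (Additive A →+ V) ≤ Nat.card (A ⧸ H → V) := Nat.card_le_card_of_injective Φ hinj
    _ = Nat.card V ^ Nat.card (A ⧸ H) := Nat.card_fun
    _ = Nat.card V ^ H.index := by rw [Subgroup.index_eq_card]

/-- `[Cl : Cl^q]` is invariant under isomorphism of (class) groups. [folklore] -/
private theorem index_range_pow_eq_of_mulEquiv {G H : Type*} [CommGroup G] [CommGroup H] (e : G ≃* H) (q : ℕ) :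
    (powMonoidHom q : H →* H).range.index = (powMonoidHom q : G →* G).range.index := by
  have hmap : (powMonoidHom q : G →* G).range.map e.toMonoidHom = (powMonoidHom q : H →* H).range := by
    ext h
    constructor
    · rintro ⟨x, ⟨y, rfl⟩, rfl⟩
      exact ⟨e y, by rw [powMonoidHom_apply, powMonoidHom_apply, MulEquiv.coe_toMonoidHom, map_pow]⟩
    · rintro ⟨y, rfl⟩
      refine ⟨e.symm y ^ q, ⟨e.symm y, rfl⟩, ?_⟩
      rw [powMonoidHom_apply, MulEquiv.coe_toMonoidHom, map_pow, MulEquiv.apply_symm_apply]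
  rw [← hmap, Subgroup.index_map_of_bijective e.bijective]

/-! ## §2 Equivariant additive maps on `Cl(L)` restrict injectively to `Cl(L^{H_P})` -/

variable {K : Type} [Field K] [NumberField K]

/-- **An equivariant additive map `Cl(𝓞_L) → V` vanishing on the classes extended from the fixed field of the
stabiliser of a point is zero.**  Setting: `L ⊆ K̄` finite Galois over the number field `K`; `Γ₀ ≤ Γ_K`;
`V` a finite `p`-torsion `Γ_K`-module on which `Gal(K̄/L)` acts trivially and whose only `Γ₀`-stable subgroups
are `⊥` and `⊤`; `P ∈ V ∖ 0`; `H_P ≤ Gal(L/K)` the image of `Stab_{Γ₀}(P)`, of order prime to `p`.  If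
`ν : Cl(𝓞_L) → V` is additive and `Γ₀`-equivariant (`ν(γ|_L · c) = γ • ν(c)`) and `ν ∘ i_{L/L^{H_P}} = 0`, then
`ν = 0`.  Proof: `ν(i(N c)) = ∑_{h ∈ H_P} h̃ • ν(c)` (Neukirch III (1.6)(iv) on classes, tree
`classGroupExtend_classGroupNorm_fixedField_eq_prod`), so the averaging operator `T = ∑_{h ∈ H_P} h̃` kills
`ν(Cl_L)`; `T(P) = #H_P · P ≠ 0`; the subgroup `{v : T(δ v) = 0 ∀ δ ∈ Γ₀}` is `Γ₀`-stable, contains `ν(Cl_L)`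
(equivariance) and not `P`, hence is `⊥`.
[cite: NeukirchANT1999, Ch. III §1 Prop. (1.6) (iv)]
[cite: DeoRaySujatha2023, §3 Thm. 3.8 (c2) and Lemma 5.1 (descent of Hom_G(Cl(L), E[p]) to the field ℚ(P))] -/
theorem equivariantHom_eq_zero_of_comp_classGroupExtend_fixedField_eq_zero
    (L : IntermediateField K (AlgebraicClosure K)) [FiniteDimensional K L] [IsGalois K L] [NumberField L]
    (Γ₀ : Subgroup (absoluteGaloisGroup K))
    {V : Type*} [AddCommGroup V] [DistribMulAction (absoluteGaloisGroup K) V]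
    {p : ℕ} [Fact p.Prime] (hpV : ∀ v : V, p • v = 0)
    (hirr : ∀ U : AddSubgroup V, (∀ γ ∈ Γ₀, ∀ v ∈ U, γ • v ∈ U) → U = ⊥ ∨ U = ⊤)
    (P : V) (hP0 : P ≠ 0)
    (hH : ¬ p ∣ Nat.card
      ↥((MulAction.stabilizer (absoluteGaloisGroup K) P ⊓ Γ₀).map (absRestrictNormalHom L)))
    (ν : Additive (ClassGroup (𝓞 L)) →+ V)
    (hν : ∀ γ ∈ Γ₀, ∀ c : ClassGroup (𝓞 L),
      ν (Additive.ofMul (ClassGroup.mulEquiv (AmbiguousClass.intAut (absRestrictNormalHom L γ)) c)) =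
        γ • ν (Additive.ofMul c))
    (hνi : ∀ d : ClassGroup (𝓞 ↥(fixedField
        ((MulAction.stabilizer (absoluteGaloisGroup K) P ⊓ Γ₀).map (absRestrictNormalHom L)))),
      ν (Additive.ofMul (classGroupExtend
        ↥(fixedField ((MulAction.stabilizer (absoluteGaloisGroup K) P ⊓ Γ₀).map (absRestrictNormalHom L)))
        L d)) = 0) :
    ν = 0 := by
  have hp : p.Prime := Fact.out
  set S : Subgroup (L ≃ₐ[K] L) :=
    (MulAction.stabilizer (absoluteGaloisGroup K) P ⊓ Γ₀).map (absRestrictNormalHom L) with hSdef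
  -- lifts of the elements of `S = H_P` to `Stab(P) ∩ Γ₀`
  have hlift : ∀ s : S, ∃ g : absoluteGaloisGroup K,
      g ∈ MulAction.stabilizer (absoluteGaloisGroup K) P ⊓ Γ₀ ∧ absRestrictNormalHom L g = s := fun s =>
    Subgroup.mem_map.mp s.2
  choose lift hlift_mem hlift_res using hlift
  have hliftP : ∀ s : S, lift s • P = P := fun s =>
    MulAction.mem_stabilizer_iff.mp (Subgroup.mem_inf.mp (hlift_mem s)).1
  have hliftΓ : ∀ s : S, lift s ∈ Γ₀ := fun s => (Subgroup.mem_inf.mp (hlift_mem s)).2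
  -- the averaging operator `T = ∑_{h ∈ H_P} h̃`
  set T : V →+ V := ∑ s : S, DistribSMul.toAddMonoidHom V (lift s) with hTdef
  have hT : ∀ v : V, T v = ∑ s : S, lift s • v := by
    intro v
    rw [hTdef, AddMonoidHom.finsetSum_apply]
    rfl
  -- `ν(i(N c)) = T(ν c)`
  have hkey : ∀ c : ClassGroup (𝓞 L),
      ν (Additive.ofMul (classGroupExtend ↥(fixedField S) L (classGroupNorm ↥(fixedField S) L c))) =
        T (ν (Additive.ofMul c)) := by
    intro c
    rw [NormRelation.classGroupExtend_classGroupNorm_fixedField_eq_prod K L S c, ofMul_prod, map_sum, hT]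
    refine Finset.sum_congr rfl fun s _ => ?_
    rw [← hν (lift s) (hliftΓ s) c, hlift_res s]
  have hTν : ∀ c : ClassGroup (𝓞 L), T (ν (Additive.ofMul c)) = 0 := fun c => by
    rw [← hkey]; exact hνi _
  -- `T P = #H_P • P ≠ 0`
  have hTP : T P = (Fintype.card S) • P := by
    rw [hT]
    simp_rw [hliftP]
    rw [Finset.sum_const, Finset.card_univ]
  have hTP0 : T P ≠ 0 := by
    intro h0
    apply hP0
    have hcop : (Fintype.card S).Coprime p := by
      rw [← Nat.card_eq_fintype_card]
      exact Nat.coprime_comm.mp ((Nat.Prime.coprime_iff_not_dvd hp).mpr hH)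
    exact eq_zero_of_nsmul_eq_zero_of_coprime hcop (hTP ▸ h0) (hpV P)
  -- the `Γ₀`-stable subgroup `U = {v : T(δ v) = 0 ∀ δ ∈ Γ₀}`
  set U : AddSubgroup V := ⨅ δ : Γ₀, (T.comp (DistribSMul.toAddMonoidHom V (δ : absoluteGaloisGroup K))).ker
    with hUdef
  have hmemU : ∀ v : V, v ∈ U ↔ ∀ δ : Γ₀, T ((δ : absoluteGaloisGroup K) • v) = 0 := by
    intro v
    rw [hUdef, AddSubgroup.mem_iInf]
    refine forall_congr' fun δ => ?_
    rw [AddMonoidHom.mem_ker]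
    rfl
  have hUstab : ∀ γ ∈ Γ₀, ∀ v ∈ U, γ • v ∈ U := by
    intro γ hγ v hv
    rw [hmemU] at hv ⊢
    intro δ
    rw [← mul_smul]
    exact hv ⟨δ * γ, mul_mem δ.2 hγ⟩
  have hPU : P ∉ U := by
    intro hP
    rw [hmemU] at hP
    have h1 := hP ⟨1, one_mem _⟩
    rw [Subgroup.coe_mk, one_smul] at h1
    exact hTP0 h1
  have hUbot : U = ⊥ := by
    rcases hirr U hUstab with h | h
    · exact h
    · exact absurd (h ▸ AddSubgroup.mem_top P) hPU
  have hνU : ∀ c : ClassGroup (𝓞 L), ν (Additive.ofMul c) ∈ U := by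
    intro c
    rw [hmemU]
    intro δ
    rw [← hν δ δ.2 c]
    exact hTν _
  refine AddMonoidHom.ext fun a => ?_
  have h := hνU (Additive.toMul a)
  rw [ofMul_toMul, hUbot, AddSubgroup.mem_bot] at h
  rw [h, AddMonoidHom.zero_apply]

/-- **Counting form.**  In the setting of the previous theorem, restriction along `i_{L/L^{H_P}}`
(`μ ↦ μ ∘ i`) is injective on the `Γ₀`-equivariant additive maps `Cl(𝓞_L) → V`, so their number is at most
`#Hom(Cl(𝓞_{L^{H_P}}), V)`. [cite: DeoRaySujatha2023, §3 Thm. 3.8 (c2) and Lemma 5.1]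
[cite: NeukirchANT1999, Ch. III §1 Prop. (1.6) (iv)] -/
theorem natCard_equivariantHom_le_natCard_hom_fixedField
    (L : IntermediateField K (AlgebraicClosure K)) [FiniteDimensional K L] [IsGalois K L]
    (Γ₀ : Subgroup (absoluteGaloisGroup K))
    {V : Type*} [AddCommGroup V] [Finite V] [DistribMulAction (absoluteGaloisGroup K) V]
    {p : ℕ} [Fact p.Prime] (hpV : ∀ v : V, p • v = 0)
    (hirr : ∀ U : AddSubgroup V, (∀ γ ∈ Γ₀, ∀ v ∈ U, γ • v ∈ U) → U = ⊥ ∨ U = ⊤)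
    (P : V) (hP0 : P ≠ 0)
    (hH : ¬ p ∣ Nat.card
      ↥((MulAction.stabilizer (absoluteGaloisGroup K) P ⊓ Γ₀).map (absRestrictNormalHom L))) :
    Nat.card {μ : Additive (ClassGroup (𝓞 L)) →+ V //
        ∀ γ ∈ Γ₀, ∀ c : ClassGroup (𝓞 L),
          μ (Additive.ofMul (ClassGroup.mulEquiv (AmbiguousClass.intAut (absRestrictNormalHom L γ)) c)) =
            γ • μ (Additive.ofMul c)} ≤
      Nat.card (Additive (ClassGroup (𝓞 ↥(fixedField
        ((MulAction.stabilizer (absoluteGaloisGroup K) P ⊓ Γ₀).map (absRestrictNormalHom L))))) →+ V) := by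
  haveI : NumberField L := NumberField.of_module_finite K L
  set S : Subgroup (L ≃ₐ[K] L) :=
    (MulAction.stabilizer (absoluteGaloisGroup K) P ⊓ Γ₀).map (absRestrictNormalHom L) with hSdef
  haveI : Finite (Additive (ClassGroup (𝓞 ↥(fixedField S))) →+ V) :=
    Finite.of_injective (fun ν => (ν : Additive (ClassGroup (𝓞 ↥(fixedField S))) → V))
      (fun ν ν' h => DFunLike.coe_injective h)
  let Φ : {μ : Additive (ClassGroup (𝓞 L)) →+ V //
        ∀ γ ∈ Γ₀, ∀ c : ClassGroup (𝓞 L),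
          μ (Additive.ofMul (ClassGroup.mulEquiv (AmbiguousClass.intAut (absRestrictNormalHom L γ)) c)) =
            γ • μ (Additive.ofMul c)} →
      (Additive (ClassGroup (𝓞 ↥(fixedField S))) →+ V) :=
    fun μ => μ.1.comp (MonoidHom.toAdditive (classGroupExtend ↥(fixedField S) L))
  have hΦ : ∀ μ d, Φ μ (Additive.ofMul d) =
      μ.1 (Additive.ofMul (classGroupExtend ↥(fixedField S) L d)) := fun _ _ => rfl
  refine Nat.card_le_card_of_injective Φ fun μ μ' h => ?_
  apply Subtype.ext
  rw [← sub_eq_zero]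
  refine equivariantHom_eq_zero_of_comp_classGroupExtend_fixedField_eq_zero L Γ₀ hpV hirr P hP0 hH
    (μ.1 - μ'.1) (fun γ hγ c => ?_) (fun d => ?_)
  · rw [AddMonoidHom.sub_apply, AddMonoidHom.sub_apply, μ.2 γ hγ c, μ'.2 γ hγ c, smul_sub]
  · rw [AddMonoidHom.sub_apply, ← hΦ μ d, ← hΦ μ' d, h, sub_self]

/-! ## §3 The fields `K̄^{U ∩ κ⁻¹(pⁿℤ_p)}`, the subgroups `H_{P,n}`, and irreducibility under `Gal(K̄/K_n)` -/

section Tower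

variable {p : ℕ} [Fact p.Prime]

/-- **`K̄^{U ∩ κ⁻¹(pⁿℤ_p)} = K̄^U ⊔ K_n`** inside `K̄` for an open `U ≤ Γ_K` (both sides have the same open fixing
subgroup; Krull's correspondence `InfiniteGalois.fixedField_fixingSubgroup`).  The case `U = Gal(K̄/K(E[p]))` is the
tree's `CoatesSujatha2005.fixedField_inf_layerSubgroup_eq`. [cite: Washington1997, §13.1 (the layers `LK_n` of `LK_∞/L`)]
[cite: NeukirchANT1999, Ch. IV §1 Thm. (1.2) (Krull)] -/
theorem fixedField_inf_layerSubgroup_eq_fixedField_sup_layer [NeZero p] (κ : ZpExtension K p)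
    (U : Subgroup (absoluteGaloisGroup K)) (hU : IsOpen (U : Set (absoluteGaloisGroup K))) (n : ℕ) :
    (fixedField (U ⊓ κ.layerSubgroup n) : IntermediateField K (AlgebraicClosure K)) =
      fixedField U ⊔ κ.layer n := by
  haveI : Algebra.IsAlgebraic K (AlgebraicClosure K) := AlgebraicClosure.isAlgebraic K
  haveI : IsGalois K (AlgebraicClosure K) := {}
  set E : IntermediateField K (AlgebraicClosure K) := fixedField (U ⊓ κ.layerSubgroup n) with hE
  have hopen : IsOpen ((U ⊓ κ.layerSubgroup n : Subgroup (absoluteGaloisGroup K)) : Set (absoluteGaloisGroup K)) :=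
    hU.inter (κ.isOpen_layerSubgroup n)
  have h1 : E.fixingSubgroup = U ⊓ κ.layerSubgroup n := fixingSubgroup_fixedField_of_isOpen _ hopen
  have hmap : ∀ H : Subgroup (absoluteGaloisGroup K),
      H.map (absoluteGaloisGroup.toAlgEquiv K).toMonoidHom = H := by
    intro H
    ext x
    constructor
    · rintro ⟨y, hy, rfl⟩; exact hy
    · intro hx; exact ⟨x, hx, rfl⟩
  have h2 : ((fixedField U : IntermediateField K (AlgebraicClosure K)) ⊔ κ.layer n).fixingSubgroup =
      U ⊓ κ.layerSubgroup n := by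
    rw [IntermediateField.fixingSubgroup_sup, fixingSubgroup_fixedField_of_isOpen U hU, κ.fixingSubgroup_layer n,
      hmap]
    rfl
  rw [← InfiniteGalois.fixedField_fixingSubgroup E,
    ← InfiniteGalois.fixedField_fixingSubgroup ((fixedField U : IntermediateField K (AlgebraicClosure K)) ⊔ κ.layer n),
    h1, h2]

omit [NumberField K] [Fact p.Prime] in
/-- **`L^{res_L(U)} = K̄^{U}`** (as subfields of `K̄`, through `IntermediateField.lift`) for `L = K̄^{V} ⊆ K̄` normal
over `K` and `V ≤ U ≤ Γ_K`: an element of `L` is fixed by the restrictions `res_L(U) ≤ Gal(L/K)` iff it is fixed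
by `U`. [cite: NeukirchANT1999, Ch. IV §1 Thm. (1.2) (Krull's Galois correspondence)] -/
theorem lift_fixedField_map_absRestrictNormalHom_eq (L : IntermediateField K (AlgebraicClosure K)) [Normal K L]
    (U V : Subgroup (absoluteGaloisGroup K)) (hVU : V ≤ U) (hL : fixedField V = L) :
    IntermediateField.lift (fixedField (U.map (absRestrictNormalHom L)) : IntermediateField K L) =
      fixedField U := by
  subst hL
  set L : IntermediateField K (AlgebraicClosure K) := fixedField V with hL
  have hres : ∀ (γ : absoluteGaloisGroup K) (z : L),
      ((absRestrictNormalHom L γ z : L) : AlgebraicClosure K) = γ • (z : AlgebraicClosure K) := fun γ z =>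
    AlgEquiv.restrictNormalHom_apply L _ z
  ext x
  rw [IntermediateField.lift, IntermediateField.mem_map]
  constructor
  · rintro ⟨y, hy, rfl⟩
    rw [IntermediateField.mem_fixedField_iff] at hy ⊢
    intro g hg
    have h1 := hy (absRestrictNormalHom L g) (Subgroup.mem_map_of_mem _ hg)
    change g • (y : AlgebraicClosure K) = y
    exact (hres g y).symm.trans (congrArg (fun z : L => (z : AlgebraicClosure K)) h1)
  · intro hx
    have hxL : x ∈ L := IntermediateField.fixedField_le hVU hx
    rw [IntermediateField.mem_fixedField_iff] at hx
    refine ⟨⟨x, hxL⟩, ?_, rfl⟩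
    rw [IntermediateField.mem_fixedField_iff]
    rintro s hs
    obtain ⟨g, hg, rfl⟩ := Subgroup.mem_map.mp hs
    apply Subtype.ext
    exact (hres g ⟨x, hxL⟩).trans (hx g hg)

variable (W : WeierstrassCurve K) [W.IsElliptic]

omit [Fact p.Prime] in
/-- **`#res_L(S) ∣ #Gal(K(E[p])/K)`** for `S ≤ Γ₀ ≤ Γ_K` and `L ⊆ K̄` normal over `K` with
`Gal(K̄/L) = Gal(K̄/K(E[p])) ∩ Γ₀`: the two restrictions of `S` (to `L` and to `K(E[p])`) have the same kernel
`S ∩ Gal(K̄/K(E[p]))`, so `res_L(S) ≅ res_{K(E[p])}(S) ≤ Gal(K(E[p])/K)` (Lagrange).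
[cite: SilvermanAEC2009, VIII.§1 (Gal(K(E[m])/K) ↪ Aut(E[m]))] [cite: NeukirchANT1999, Ch. IV §1] -/
theorem natCard_map_absRestrictNormalHom_dvd_card_aut_divisionField [NeZero p]
    (L : IntermediateField K (AlgebraicClosure K)) [Normal K L] (Γ₀ S : Subgroup (absoluteGaloisGroup K))
    (hS : S ≤ Γ₀)
    (hL : ∀ σ : absoluteGaloisGroup K, absRestrictNormalHom L σ = 1 ↔
      σ ∈ fixingSubgroupOfModule K ↥(W.geomTorsion (p : ℤ)) ⊓ Γ₀) :
    Nat.card ↥(S.map (absRestrictNormalHom L)) ∣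
      Nat.card ((W.divisionField p) ≃ₐ[K] (W.divisionField p)) := by
  set r₁ : ↥S →* (L ≃ₐ[K] L) := (absRestrictNormalHom L).comp S.subtype with hr₁
  set r₂ : ↥S →* ((W.divisionField p) ≃ₐ[K] (W.divisionField p)) :=
    (absRestrictNormalHom (W.divisionField p)).comp S.subtype with hr₂
  have hrange : S.map (absRestrictNormalHom L) = r₁.range := by
    rw [hr₁, ← MonoidHom.map_range, Subgroup.range_subtype]
  have hker : r₁.ker = r₂.ker := by
    ext σ
    rw [MonoidHom.mem_ker, MonoidHom.mem_ker]
    change absRestrictNormalHom L (σ : absoluteGaloisGroup K) = 1 ↔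
      absRestrictNormalHom (W.divisionField p) (σ : absoluteGaloisGroup K) = 1
    rw [hL, W.absRestrictNormalHom_divisionField_eq_one_iff p, Subgroup.mem_inf,
      W.mem_fixingSubgroupOfModule_geomTorsion_iff]
    exact ⟨fun h => h.1, fun h => ⟨h, hS σ.2⟩⟩
  calc Nat.card ↥(S.map (absRestrictNormalHom L)) = Nat.card ↥r₁.range := by rw [hrange]
    _ = Nat.card (↥S ⧸ r₁.ker) := Nat.card_congr (QuotientGroup.quotientKerEquivRange r₁).symm.toEquiv
    _ = Nat.card (↥S ⧸ r₂.ker) := by rw [hker]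
    _ = Nat.card ↥r₂.range := Nat.card_congr (QuotientGroup.quotientKerEquivRange r₂).toEquiv
    _ ∣ Nat.card ((W.divisionField p) ≃ₐ[K] (W.divisionField p)) := Subgroup.card_subgroup_dvd_card r₂.range

/-- **Irreducibility under `Gal(K̄/K_n)` from irreducibility under `Γ_K` and tameness.**  If `E[p]` is an
irreducible `Γ_K`-module and `p ∤ #Gal(K(E[p])/K)`, then for every `ℤ_p`-extension `κ` of `K` and every `n` the
only `Gal(K̄/K_n)`-stable subgroups of `E[p]` are `⊥` and `⊤`: `[Γ_K : Gal(K̄/K_n)] = pⁿ` is prime to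
`[Γ_K : Gal(K̄/K(E[p]))]`, so `Γ_K = Gal(K̄/K_n) · Gal(K̄/K(E[p]))`, and `Gal(K̄/K(E[p]))` acts trivially.
[cite: DeoRaySujatha2023, §5 Lemma 5.1 (the tame case (c1): p ∤ #Gal(ℚ(E[p])/ℚ))] [cite: Washington1997, §13.1] -/
theorem irreducible_layerSubgroup_of_not_dvd_card_aut_divisionField [NeZero p] (κ : ZpExtension K p)
    (hirr : W.HasIrreducibleModPGaloisRep p)
    (hG : ¬ p ∣ Nat.card ((W.divisionField p) ≃ₐ[K] (W.divisionField p))) (n : ℕ)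
    (U : AddSubgroup ↥(W.geomTorsion (p : ℤ)))
    (hU : ∀ γ ∈ κ.layerSubgroup n, ∀ v ∈ U, γ • v ∈ U) : U = ⊥ ∨ U = ⊤ := by
  have hpr : p.Prime := Fact.out
  set N : Subgroup (absoluteGaloisGroup K) := fixingSubgroupOfModule K ↥(W.geomTorsion (p : ℤ)) with hNdef
  haveI : N.Normal := W.fixingSubgroupOfModule_geomTorsion_normal p
  -- `[Γ_K : N] = #Gal(K(E[p])/K)`
  have hidx : N.index = Nat.card ((W.divisionField p) ≃ₐ[K] (W.divisionField p)) := by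
    rw [IsGalois.card_aut_eq_finrank]
    exact (finrank_fixedField_of_isOpen N (W.isOpen_fixingSubgroupOfModule_geomTorsion p)).symm
  -- `κ⁻¹(pⁿℤ_p) ⊔ N = Γ_K`
  have hsup : κ.layerSubgroup n ⊔ N = ⊤ := by
    have h1 : (κ.layerSubgroup n ⊔ N).index ∣ p ^ n := by
      rw [← κ.index_layerSubgroup n]
      exact Subgroup.index_dvd_of_le le_sup_left
    have h2 : (κ.layerSubgroup n ⊔ N).index ∣ N.index := Subgroup.index_dvd_of_le le_sup_right
    obtain ⟨k, -, hk⟩ := (Nat.dvd_prime_pow hpr).mp h1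
    rcases k with _ | k
    · exact Subgroup.index_eq_one.mp (by rw [hk, pow_zero])
    · exfalso
      apply hG
      rw [← hidx]
      exact (dvd_pow_self p (Nat.succ_ne_zero k)).trans (hk ▸ h2)
  refine hirr U fun σ v hv => ?_
  have hσ : σ ∈ ((κ.layerSubgroup n ⊔ N : Subgroup (absoluteGaloisGroup K)) : Set (absoluteGaloisGroup K)) := by
    rw [hsup]; exact Subgroup.mem_top σ
  rw [Subgroup.mul_normal] at hσ
  obtain ⟨γ, hγ, ν, hν, rfl⟩ := Set.mem_mul.mp hσ
  rw [mul_smul, smul_eq_of_mem_fixingSubgroupOfModule hν v]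
  exact hU γ hγ v hv

end Tower

end Literature.NumberTheory.EllipticCurves.FineSelmerStabilizerDescent

/-! ## §4 Statement (A) from the class groups along the cyclotomic tower of the torsion-point field `K(P)` -/

namespace Literature.NumberTheory.EllipticCurves.CoatesSujatha2005

open WeierstrassCurve Literature.NumberTheory.IwasawaTheory Literature.NumberTheory.GaloisRepresentations
  Literature.NumberTheory.NumberFields Literature.NumberTheory.EllipticCurves
  Literature.NumberTheory.EllipticCurves.GreenbergSelmer Literature.NumberTheory.EllipticCurves.ZpExtension
  Literature.NumberTheory.IwasawaTheory.EquivariantUnramifiedHomsZpTowerFinite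
  Literature.NumberTheory.EllipticCurves.FineSelmerStabilizerDescent

variable {K : Type} [Field K] [NumberField K] (W : WeierstrassCurve K) [W.IsElliptic] {p : ℕ} [Fact p.Prime]

/-- **Statement (A) from bounded `[Cl(F_n) : Cl(F_n)^p]` along `F_n = (K(E[p])·K_n)^{H_{P,n}}`** (general
form).  `E = W` elliptic over a number field `K`, `p` odd, `E[p]` irreducible and tame (`p ∤ #Gal(K(E[p])/K)`),
`P ∈ E[p] ∖ 0`, `κ` the cyclotomic `ℤ_p`-extension of `K`, `L_n = K̄^{N ∩ κ⁻¹(pⁿℤ_p)}` (`N = Gal(K̄/K(E[p]))`),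
`H_{P,n} ≤ Gal(L_n/K)` the image of `Stab(P) ∩ κ⁻¹(pⁿℤ_p)`, `F_n = L_n^{H_{P,n}}` (`= K(P)·K_n`).  If the index of
the `p`-th powers in `Cl(𝓞_{F_n})` is `≤ C` for every `n`, then the dual fine Selmer group of `E` over `K_∞` is
finitely generated over `ℤ_p`. [cite: CoatesSujatha2005, §3 Lemma 3.8 and Thm. 3.4]
[cite: DeoRaySujatha2023, §3 Thm. 3.9 (b) and §5 Lemma 5.1 (descent to ℚ(P))] [cite: Lim2017FineSelmer, §3] -/
theorem fineSelmerDual_moduleFinite_of_index_stabilizer_layer_le (hp : p ≠ 2)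
    (hirr : W.HasIrreducibleModPGaloisRep p)
    (hG : haveI : NeZero p := ⟨(Fact.out : p.Prime).ne_zero⟩
      ¬ p ∣ Nat.card ((W.divisionField p) ≃ₐ[K] (W.divisionField p)))
    (P : ↥(W.geomTorsion (p : ℤ))) (hP0 : P ≠ 0) (κ : ZpExtension K p) (hκ : κ.IsCyclotomic) (C : ℕ)
    (hC : ∀ n : ℕ,
      haveI := W.fixingSubgroupOfModule_geomTorsion_normal p
      haveI : IsGalois K (fixedField (fixingSubgroupOfModule K ↥(W.geomTorsion (p : ℤ)) ⊓ κ.layerSubgroup n) :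
          IntermediateField K (AlgebraicClosure K)) :=
        isGalois_fixedField_inf_layerSubgroup κ (fixingSubgroupOfModule K ↥(W.geomTorsion (p : ℤ)))
          (W.isOpen_fixingSubgroupOfModule_geomTorsion p) n
      (powMonoidHom p : ClassGroup (𝓞 ↥(fixedField
          ((MulAction.stabilizer (absoluteGaloisGroup K) P ⊓ κ.layerSubgroup n).map
            (absRestrictNormalHom (fixedField
              (fixingSubgroupOfModule K ↥(W.geomTorsion (p : ℤ)) ⊓ κ.layerSubgroup n) :
                IntermediateField K (AlgebraicClosure K)))) :
          IntermediateField K ↥(fixedField (fixingSubgroupOfModule K ↥(W.geomTorsion (p : ℤ)) ⊓ κ.layerSubgroup n) :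
            IntermediateField K (AlgebraicClosure K)))) →* _).range.index ≤ C) :
    ∃ (γ : absoluteGaloisGroup K) (D : W.FineSelmerDualData κ γ),
      Module.Finite ℤ_[p] (RestrictScalars ℤ_[p] (IwasawaAlgebra p) D.X) := by
  have hpr : p.Prime := Fact.out
  haveI : NeZero p := ⟨hpr.ne_zero⟩
  haveI : Finite ↥(W.geomTorsion (p : ℤ)) := W.finite_geomTorsion_nat hpr.ne_zero
  haveI : ContinuousSMul (absoluteGaloisGroup K) ↥(W.geomTorsion (p : ℤ)) :=
    WeierstrassCurve.continuousSMul_geomTorsion W (WeierstrassCurve.isOpen_stabilizer_point_holds W) (p : ℤ)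
  set N : Subgroup (absoluteGaloisGroup K) := fixingSubgroupOfModule K ↥(W.geomTorsion (p : ℤ)) with hNdef
  haveI : N.Normal := W.fixingSubgroupOfModule_geomTorsion_normal p
  have hN : IsOpen (N : Set (absoluteGaloisGroup K)) := W.isOpen_fixingSubgroupOfModule_geomTorsion p
  have hpM : ∀ m : ↥(W.geomTorsion (p : ℤ)), p • m = 0 := fun m =>
    Subtype.ext (by
      rw [AddSubmonoidClass.coe_nsmul, ZeroMemClass.coe_zero]
      exact AddSubgroup.torsionBy.nsmul_iff.mp m.2)
  have hVpos : 0 < Nat.card ↥(W.geomTorsion (p : ℤ)) := Nat.card_pos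
  refine fineSelmerDual_moduleFinite_of_card_equivariantHom_le W hp κ hκ (Nat.card ↥(W.geomTorsion (p : ℤ)) ^ C)
    fun n => ?_
  set Ln : IntermediateField K (AlgebraicClosure K) := fixedField (N ⊓ κ.layerSubgroup n) with hLn
  have hopen : IsOpen ((N ⊓ κ.layerSubgroup n : Subgroup (absoluteGaloisGroup K)) : Set (absoluteGaloisGroup K)) :=
    hN.inter (κ.isOpen_layerSubgroup n)
  haveI hgal : IsGalois K Ln := isGalois_fixedField_inf_layerSubgroup κ N hN n
  haveI : FiniteDimensional K Ln := finiteDimensional_fixedField_of_isOpen _ hopen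
  haveI : NumberField Ln := NumberField.of_module_finite K Ln
  have hL : ∀ σ : absoluteGaloisGroup K, absRestrictNormalHom Ln σ = 1 ↔ σ ∈ N ⊓ κ.layerSubgroup n := by
    intro σ
    rw [absRestrictNormalHom_eq_one_iff]
    exact SetLike.ext_iff.mp (fixingSubgroup_fixedField_of_isOpen _ hopen) σ
  have hirr' : ∀ U : AddSubgroup ↥(W.geomTorsion (p : ℤ)),
      (∀ γ ∈ κ.layerSubgroup n, ∀ v ∈ U, γ • v ∈ U) → U = ⊥ ∨ U = ⊤ :=
    irreducible_layerSubgroup_of_not_dvd_card_aut_divisionField W κ hirr hG n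
  set S : Subgroup (Ln ≃ₐ[K] Ln) :=
    (MulAction.stabilizer (absoluteGaloisGroup K) P ⊓ κ.layerSubgroup n).map (absRestrictNormalHom Ln) with hS
  have hH : ¬ p ∣ Nat.card ↥S := fun h =>
    hG (h.trans (natCard_map_absRestrictNormalHom_dvd_card_aut_divisionField W Ln (κ.layerSubgroup n)
      (MulAction.stabilizer (absoluteGaloisGroup K) P ⊓ κ.layerSubgroup n) inf_le_right hL))
  calc Nat.card {μ : Additive (ClassGroup (𝓞 Ln)) →+ ↥(W.geomTorsion (p : ℤ)) //
          ∀ γ ∈ κ.layerSubgroup n, ∀ c,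
            μ (Additive.ofMul (ClassGroup.mulEquiv (AmbiguousClass.intAut (absRestrictNormalHom Ln γ)) c)) =
              γ • μ (Additive.ofMul c)}
        ≤ Nat.card (Additive (ClassGroup (𝓞 ↥(fixedField S))) →+ ↥(W.geomTorsion (p : ℤ))) :=
      natCard_equivariantHom_le_natCard_hom_fixedField Ln (κ.layerSubgroup n) hpM hirr' P hP0 hH
    _ ≤ Nat.card ↥(W.geomTorsion (p : ℤ)) ^
          (powMonoidHom p : ClassGroup (𝓞 ↥(fixedField S)) →* ClassGroup (𝓞 ↥(fixedField S))).range.index :=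
      natCard_addMonoidHom_le_pow_index hpM
    _ ≤ Nat.card ↥(W.geomTorsion (p : ℤ)) ^ C := Nat.pow_le_pow_right hVpos (hC n)

/-- **Coates–Sujatha's statement (A) from BOUNDED `p`-RANKS along the cyclotomic tower of ONE torsion-point
field (PROVED).**  `E = W` elliptic over a number field `K`, `p` odd, `E[p]` irreducible and tame
(`p ∤ #Gal(K(E[p])/K)`), `P ∈ E[p] ∖ 0`, `K(P) = K̄^{Stab(P)}`.  If some cyclotomic `ℤ_p`-extension `κ_P` of
`K(P)` has `rank_p Cl(K(P)_m) ≤ B` for every layer `m`, then for the cyclotomic `ℤ_p`-extension `κ` of `K` the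
dual fine Selmer group of `E` over `K_∞` is finitely generated over `ℤ_p`.  (Layers: `K(P)·K_n = K̄^{Stab(P) ∩ κ⁻¹(pⁿℤ_p)}`
is a layer of the shifted base change of `κ` to `K(P)`, tree `ZpExtension.exists_zpExtension_shift`; no hypothesis on
`K(P) ∩ K_∞`.) [cite: CoatesSujatha2005, §3 Lemma 3.8 and Thm. 3.4] [cite: DeoRaySujatha2023, §3 Thm. 3.9 (b) and §5 Lemma 5.1]
[cite: Washington1997, §13.1] -/
theorem fineSelmerDual_moduleFinite_of_classGroupPRank_stabilizerField_le (hp : p ≠ 2)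
    (hirr : W.HasIrreducibleModPGaloisRep p)
    (hG : haveI : NeZero p := ⟨(Fact.out : p.Prime).ne_zero⟩
      ¬ p ∣ Nat.card ((W.divisionField p) ≃ₐ[K] (W.divisionField p)))
    (P : ↥(W.geomTorsion (p : ℤ))) (hP0 : P ≠ 0) (κ : ZpExtension K p) (hκ : κ.IsCyclotomic) (B : ℕ)
    (hB : ∃ κP : ZpExtension ↥(fixedField (MulAction.stabilizer (absoluteGaloisGroup K) P) :
        IntermediateField K (AlgebraicClosure K)) p, κP.IsCyclotomic ∧ ∀ m, classGroupPRank κP m ≤ B) :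
    ∃ (γ : absoluteGaloisGroup K) (D : W.FineSelmerDualData κ γ),
      Module.Finite ℤ_[p] (RestrictScalars ℤ_[p] (IwasawaAlgebra p) D.X) := by
  have hpr : p.Prime := Fact.out
  haveI : NeZero p := ⟨hpr.ne_zero⟩
  haveI : Finite ↥(W.geomTorsion (p : ℤ)) := W.finite_geomTorsion_nat hpr.ne_zero
  haveI : ContinuousSMul (absoluteGaloisGroup K) ↥(W.geomTorsion (p : ℤ)) :=
    WeierstrassCurve.continuousSMul_geomTorsion W (WeierstrassCurve.isOpen_stabilizer_point_holds W) (p : ℤ)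
  set N : Subgroup (absoluteGaloisGroup K) := fixingSubgroupOfModule K ↥(W.geomTorsion (p : ℤ)) with hNdef
  haveI : N.Normal := W.fixingSubgroupOfModule_geomTorsion_normal p
  have hN : IsOpen (N : Set (absoluteGaloisGroup K)) := W.isOpen_fixingSubgroupOfModule_geomTorsion p
  set SP : Subgroup (absoluteGaloisGroup K) := MulAction.stabilizer (absoluteGaloisGroup K) P with hSP
  have hSPopen : IsOpen (SP : Set (absoluteGaloisGroup K)) := stabilizer_isOpen (absoluteGaloisGroup K) P
  have hNSP : N ≤ SP := by
    intro σ hσ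
    exact MulAction.mem_stabilizer_iff.mpr (smul_eq_of_mem_fixingSubgroupOfModule hσ P)
  set KP : IntermediateField K (AlgebraicClosure K) := fixedField SP with hKP
  haveI : FiniteDimensional K KP := finiteDimensional_fixedField_of_isOpen SP hSPopen
  haveI : NumberField KP := NumberField.of_module_finite K KP
  obtain ⟨κP, hκP, hBκ⟩ := hB
  -- the shifted base change `κ'` of `κ` to `K(P)` is cyclotomic, so has the same `p`-ranks as `κ_P`
  obtain ⟨a, κ', hs⟩ := exists_zpExtension_shift κ ↥KP
  have hκ' : κ'.IsCyclotomic := isCyclotomic_of_shift κ ↥KP κ' hs hκ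
  refine fineSelmerDual_moduleFinite_of_index_stabilizer_layer_le W hp hirr hG P hP0 κ hκ (p ^ B) fun n => ?_
  set Ln : IntermediateField K (AlgebraicClosure K) := fixedField (N ⊓ κ.layerSubgroup n) with hLn
  have hopen : IsOpen ((N ⊓ κ.layerSubgroup n : Subgroup (absoluteGaloisGroup K)) : Set (absoluteGaloisGroup K)) :=
    hN.inter (κ.isOpen_layerSubgroup n)
  haveI hgal : IsGalois K Ln := isGalois_fixedField_inf_layerSubgroup κ N hN n
  haveI : FiniteDimensional K Ln := finiteDimensional_fixedField_of_isOpen _ hopen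
  set S : Subgroup (Ln ≃ₐ[K] Ln) := (SP ⊓ κ.layerSubgroup n).map (absRestrictNormalHom Ln) with hS
  show (powMonoidHom p : ClassGroup (𝓞 ↥(fixedField S : IntermediateField K Ln)) →* _).range.index ≤ p ^ B
  -- `F_n = Ln^S ≅ K̄^{Stab(P) ∩ κ⁻¹(pⁿℤ_p)} = K(P) ⊔ K_n ≅ κ'.layer m`
  obtain ⟨m, hnm⟩ := exists_layerSubgroup_eq_comap_of_shift κ ↥KP κ' hs n
  obtain ⟨e⟩ := nonempty_ringEquiv_layer_fieldRange_sup_layer_of_layerSubgroup_eq κ ↥KP κ' hnm KP.val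
  have hfield : (KP.val.fieldRange ⊔ κ.layer n) =
      (fixedField (SP ⊓ κ.layerSubgroup n) : IntermediateField K (AlgebraicClosure K)) := by
    rw [IntermediateField.fieldRange_val, hKP, fixedField_inf_layerSubgroup_eq_fixedField_sup_layer κ SP hSPopen n]
  have hlift : IntermediateField.lift (fixedField S : IntermediateField K Ln) =
      (fixedField (SP ⊓ κ.layerSubgroup n) : IntermediateField K (AlgebraicClosure K)) :=
    lift_fixedField_map_absRestrictNormalHom_eq Ln (SP ⊓ κ.layerSubgroup n) (N ⊓ κ.layerSubgroup n)
      (inf_le_inf_right _ hNSP) hLn.symm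
  let e' : ↥(κ'.layer m) ≃+* ↥(fixedField S : IntermediateField K Ln) :=
    e.trans ((IntermediateField.equivOfEq hfield).toRingEquiv.trans
      ((IntermediateField.liftAlgEquiv (fixedField S : IntermediateField K Ln)).trans
        (IntermediateField.equivOfEq hlift)).toRingEquiv.symm)
  rw [index_range_pow_eq_of_mulEquiv (ClassGroup.mulEquiv (RingOfIntegers.mapRingEquiv e')) p,
    index_range_pow_layer_eq κ' m, classGroupPRank_eq_of_isCyclotomic κ' κP hκ' hκP m]
  exact Nat.pow_le_pow_right hpr.pos (hBκ m)

/-- **THE TORSION-POINT-FIELD `μ`-ROAD (PROVED): `μ_p(K(P)_cyc) = 0 ⟹` statement (A) for `E` at `p`.**  `E = W`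
elliptic over a number field `K`, `p` an odd prime with `E[p]` irreducible and tame (`p ∤ #Gal(K(E[p])/K)`),
`P ∈ E[p] ∖ 0`, `K(P) = K̄^{Stab(P)}`.  If every (equivalently one) cyclotomic `ℤ_p`-extension of `K(P)` has
vanishing classical `μ`-invariant (Iwasawa's growth form `IwasawaTheory.ClassicalMuVanishes`), then for the cyclotomic
`ℤ_p`-extension `κ` of `K` the Pontryagin dual of `Sel₀(E/K_∞)[p^∞]` is finitely generated over `ℤ_p` — Conjecture A of
Coates–Sujatha for `E` at `p` over `K_∞`.  The division-field form («`μ_p(K(E[p])) = 0 ⟹` (A)», Coates–Sujatha Thm. 3.4)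
is the tree's `thm34_fineSelmerDual_moduleFinite_of_classicalMuVanishes_divisionField_holds`; Deo–Ray–Sujatha's
Thm. 3.9 (b) is the case `p ∤ h(ℚ(P))` with their (c3).
[cite: CoatesSujatha2005, §3 Thm. 3.4 and Lemma 3.8] [cite: DeoRaySujatha2023, §3 Thm. 3.9 (b) and §5 Lemma 5.1]
[cite: Washington1997, §13.3 Prop. 13.23 (μ = 0 ⟹ bounded p-ranks)] -/
theorem conjA_of_classicalMuVanishes_stabilizerField (hp : p ≠ 2) (hirr : W.HasIrreducibleModPGaloisRep p)
    (hG : haveI : NeZero p := ⟨(Fact.out : p.Prime).ne_zero⟩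
      ¬ p ∣ Nat.card ((W.divisionField p) ≃ₐ[K] (W.divisionField p)))
    (P : ↥(W.geomTorsion (p : ℤ))) (hP0 : P ≠ 0)
    (hμ : ∀ κP : ZpExtension ↥(fixedField (MulAction.stabilizer (absoluteGaloisGroup K) P) :
        IntermediateField K (AlgebraicClosure K)) p, κP.IsCyclotomic → ClassicalMuVanishes κP)
    (κ : ZpExtension K p) (hκ : κ.IsCyclotomic) :
    ∃ (γ : absoluteGaloisGroup K) (D : W.FineSelmerDualData κ γ),
      Module.Finite ℤ_[p] (RestrictScalars ℤ_[p] (IwasawaAlgebra p) D.X) := by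
  have hpr : p.Prime := Fact.out
  haveI : NeZero p := ⟨hpr.ne_zero⟩
  haveI : Finite ↥(W.geomTorsion (p : ℤ)) := W.finite_geomTorsion_nat hpr.ne_zero
  haveI : ContinuousSMul (absoluteGaloisGroup K) ↥(W.geomTorsion (p : ℤ)) :=
    WeierstrassCurve.continuousSMul_geomTorsion W (WeierstrassCurve.isOpen_stabilizer_point_holds W) (p : ℤ)
  set SP : Subgroup (absoluteGaloisGroup K) := MulAction.stabilizer (absoluteGaloisGroup K) P with hSP
  have hSPopen : IsOpen (SP : Set (absoluteGaloisGroup K)) := stabilizer_isOpen (absoluteGaloisGroup K) P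
  set KP : IntermediateField K (AlgebraicClosure K) := fixedField SP with hKP
  haveI : FiniteDimensional K KP := finiteDimensional_fixedField_of_isOpen SP hSPopen
  haveI : NumberField KP := NumberField.of_module_finite K KP
  -- a cyclotomic `ℤ_p`-extension of `K(P)` exists (the shifted base change of `κ`); `μ = 0` bounds its `p`-ranks
  obtain ⟨a, κ', hs⟩ := exists_zpExtension_shift κ ↥KP
  have hκ' : κ'.IsCyclotomic := isCyclotomic_of_shift κ ↥KP κ' hs hκ
  obtain ⟨B, hB⟩ := exists_forall_classGroupPRank_le_of_classicalMuVanishes κ' (hμ κ' hκ')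
  exact fineSelmerDual_moduleFinite_of_classGroupPRank_stabilizerField_le W hp hirr hG P hP0 κ hκ B ⟨κ', hκ', hB⟩

/-! ## §5 Numeric doors at the torsion-point field `K(P)` (Iwasawa 1956, Fukuda 1994 Thm. 1 (1)/(2)) -/

/-- **Door L8.1 (Iwasawa 1956 at `K(P)`): `p ∤ h(K(P))` and ONE prime of `K(P)` above `p` ⟹ statement (A).**  `E = W`
elliptic over a number field `K`, `p` odd, `E[p]` irreducible and tame, `P ∈ E[p] ∖ 0`, `K(P) = K̄^{Stab(P)}`: if `p` does
not divide the class number of `K(P)` and exactly one prime of `K(P)` lies above `p`, then `p ∤ h(K(P)_m)` for every layer of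
every `ℤ_p`-extension of `K(P)` (Iwasawa, tree `iwasawa1956_…_holds`), so the `p`-ranks vanish and (A) holds for `E` at `p`.
(Deo–Ray–Sujatha Thm. 3.9 (b) asks `p ∤ h(ℚ(P))` together with their (c3) at the primes above `p` and the bad primes; here
(c3) is replaced by «one prime of `ℚ(P)` above `p`».) [cite: Greenberg2001IwasawaPastPresent, Prop. 2.1 p. 339]
[cite: DeoRaySujatha2023, §3 Thm. 3.9 (b)] [cite: CoatesSujatha2005, §3 Thm. 3.4] -/
theorem conjA_of_not_dvd_classNumber_stabilizerField_of_unique_prime (hp : p ≠ 2)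
    (hirr : W.HasIrreducibleModPGaloisRep p)
    (hG : haveI : NeZero p := ⟨(Fact.out : p.Prime).ne_zero⟩
      ¬ p ∣ Nat.card ((W.divisionField p) ≃ₐ[K] (W.divisionField p)))
    (P : ↥(W.geomTorsion (p : ℤ))) (hP0 : P ≠ 0)
    (hh : ∀ [NumberField ↥(fixedField (MulAction.stabilizer (absoluteGaloisGroup K) P) :
        IntermediateField K (AlgebraicClosure K))],
      ¬ p ∣ NumberField.classNumber ↥(fixedField (MulAction.stabilizer (absoluteGaloisGroup K) P) :
        IntermediateField K (AlgebraicClosure K)))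
    (hv : ∃! v : HeightOneSpectrum (𝓞 ↥(fixedField (MulAction.stabilizer (absoluteGaloisGroup K) P) :
        IntermediateField K (AlgebraicClosure K))),
      ((p : ℕ) : 𝓞 ↥(fixedField (MulAction.stabilizer (absoluteGaloisGroup K) P) :
        IntermediateField K (AlgebraicClosure K))) ∈ v.asIdeal)
    (κ : ZpExtension K p) (hκ : κ.IsCyclotomic) :
    ∃ (γ : absoluteGaloisGroup K) (D : W.FineSelmerDualData κ γ),
      Module.Finite ℤ_[p] (RestrictScalars ℤ_[p] (IwasawaAlgebra p) D.X) := by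
  have hpr : p.Prime := Fact.out
  haveI : NeZero p := ⟨hpr.ne_zero⟩
  haveI : Finite ↥(W.geomTorsion (p : ℤ)) := W.finite_geomTorsion_nat hpr.ne_zero
  haveI : ContinuousSMul (absoluteGaloisGroup K) ↥(W.geomTorsion (p : ℤ)) :=
    WeierstrassCurve.continuousSMul_geomTorsion W (WeierstrassCurve.isOpen_stabilizer_point_holds W) (p : ℤ)
  set SP : Subgroup (absoluteGaloisGroup K) := MulAction.stabilizer (absoluteGaloisGroup K) P with hSP
  have hSPopen : IsOpen (SP : Set (absoluteGaloisGroup K)) := stabilizer_isOpen (absoluteGaloisGroup K) P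
  set KP : IntermediateField K (AlgebraicClosure K) := fixedField SP with hKP
  haveI : FiniteDimensional K KP := finiteDimensional_fixedField_of_isOpen SP hSPopen
  haveI : NumberField KP := NumberField.of_module_finite K KP
  obtain ⟨a, κ', hs⟩ := exists_zpExtension_shift κ ↥KP
  have hκ' : κ'.IsCyclotomic := isCyclotomic_of_shift κ ↥KP κ' hs hκ
  refine fineSelmerDual_moduleFinite_of_classGroupPRank_stabilizerField_le W hp hirr hG P hP0 κ hκ 0
    ⟨κ', hκ', fun m => ?_⟩
  have h0 := iwasawa1956_classNumberPExp_eq_zero_of_not_dvd_classNumber_of_unique_prime_holds ↥KP p hh hv κ' m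
  have := classGroupPRank_le_classNumberPExp κ' m
  omega

/-- **Door L8.2 (Fukuda 1994 Thm. 1 (1) at `K(P)`): `ord_p h(K(P)_{n+1}) = ord_p h(K(P)_n)` for ONE `n` ⟹ statement (A)**,
provided every cyclotomic `ℤ_p`-extension of `K(P)` is totally ramified at the primes above `p` from layer `0`
(`TotallyRamifiedFrom κ_P 0`, Fukuda's `n₀ = 0`).  Setting as in Door L8.1.  The class numbers are then constant from `n`
on, so `μ_p(K(P)_cyc) = 0` (tree `classicalMuVanishes_of_classNumberPExp_succ_eq'`) and `conjA_of_classicalMuVanishes_stabilizerField`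
applies. [cite: Fukuda1994, Thm. 1 (1), p. 264] [cite: CoatesSujatha2005, §3 Thm. 3.4] [cite: DeoRaySujatha2023, §5 Lemma 5.1] -/
theorem conjA_of_classNumberPExp_stabilizerField_succ_eq (hp : p ≠ 2) (hirr : W.HasIrreducibleModPGaloisRep p)
    (hG : haveI : NeZero p := ⟨(Fact.out : p.Prime).ne_zero⟩
      ¬ p ∣ Nat.card ((W.divisionField p) ≃ₐ[K] (W.divisionField p)))
    (P : ↥(W.geomTorsion (p : ℤ))) (hP0 : P ≠ 0) (n : ℕ)
    (hram : ∀ κP : ZpExtension ↥(fixedField (MulAction.stabilizer (absoluteGaloisGroup K) P) :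
        IntermediateField K (AlgebraicClosure K)) p, κP.IsCyclotomic → TotallyRamifiedFrom κP 0)
    (hord : ∀ κP : ZpExtension ↥(fixedField (MulAction.stabilizer (absoluteGaloisGroup K) P) :
        IntermediateField K (AlgebraicClosure K)) p, κP.IsCyclotomic →
        classNumberPExp κP (n + 1) = classNumberPExp κP n)
    (κ : ZpExtension K p) (hκ : κ.IsCyclotomic) :
    ∃ (γ : absoluteGaloisGroup K) (D : W.FineSelmerDualData κ γ),
      Module.Finite ℤ_[p] (RestrictScalars ℤ_[p] (IwasawaAlgebra p) D.X) := by
  have hpr : p.Prime := Fact.out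
  haveI : NeZero p := ⟨hpr.ne_zero⟩
  haveI : Finite ↥(W.geomTorsion (p : ℤ)) := W.finite_geomTorsion_nat hpr.ne_zero
  haveI : ContinuousSMul (absoluteGaloisGroup K) ↥(W.geomTorsion (p : ℤ)) :=
    WeierstrassCurve.continuousSMul_geomTorsion W (WeierstrassCurve.isOpen_stabilizer_point_holds W) (p : ℤ)
  haveI : FiniteDimensional K ↥(fixedField (MulAction.stabilizer (absoluteGaloisGroup K) P) :
      IntermediateField K (AlgebraicClosure K)) :=
    finiteDimensional_fixedField_of_isOpen _ (stabilizer_isOpen (absoluteGaloisGroup K) P)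
  haveI : NumberField ↥(fixedField (MulAction.stabilizer (absoluteGaloisGroup K) P) :
      IntermediateField K (AlgebraicClosure K)) := NumberField.of_module_finite K _
  exact conjA_of_classicalMuVanishes_stabilizerField W hp hirr hG P hP0
    (fun κP hκP => classicalMuVanishes_of_classNumberPExp_succ_eq' κP (hram κP hκP) (Nat.zero_le n) (hord κP hκP))
    κ hκ

/-- **Door L8.3 (Fukuda 1994 Thm. 1 (2) at `K(P)`): `rank_p Cl(K(P)_{n+1}) = rank_p Cl(K(P)_n)` for ONE `n` ⟹ statement (A)**,
provided every cyclotomic `ℤ_p`-extension of `K(P)` has `TotallyRamifiedFrom κ_P 0`.  Setting as in Door L8.1.  The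
`p`-ranks are then constant from `n` on, so `μ_p(K(P)_cyc) = 0` (tree `classicalMuVanishes_of_classGroupPRank_succ_eq'`).
For `K = ℚ`, `p = 3` and the normaliser-of-non-split-Cartan rows this is ONE comparison of the `3`-ranks of the class
groups of the octic field `ℚ(P)` and of the degree-`24` field `ℚ(P)·ℚ₁`.
[cite: Fukuda1994, Thm. 1 (2), p. 264] [cite: CoatesSujatha2005, §3 Thm. 3.4] [cite: DeoRaySujatha2023, §5 Lemma 5.1] -/
theorem conjA_of_classGroupPRank_stabilizerField_succ_eq (hp : p ≠ 2) (hirr : W.HasIrreducibleModPGaloisRep p)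
    (hG : haveI : NeZero p := ⟨(Fact.out : p.Prime).ne_zero⟩
      ¬ p ∣ Nat.card ((W.divisionField p) ≃ₐ[K] (W.divisionField p)))
    (P : ↥(W.geomTorsion (p : ℤ))) (hP0 : P ≠ 0) (n : ℕ)
    (hram : ∀ κP : ZpExtension ↥(fixedField (MulAction.stabilizer (absoluteGaloisGroup K) P) :
        IntermediateField K (AlgebraicClosure K)) p, κP.IsCyclotomic → TotallyRamifiedFrom κP 0)
    (hrk : ∀ κP : ZpExtension ↥(fixedField (MulAction.stabilizer (absoluteGaloisGroup K) P) :
        IntermediateField K (AlgebraicClosure K)) p, κP.IsCyclotomic →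
        classGroupPRank κP (n + 1) = classGroupPRank κP n)
    (κ : ZpExtension K p) (hκ : κ.IsCyclotomic) :
    ∃ (γ : absoluteGaloisGroup K) (D : W.FineSelmerDualData κ γ),
      Module.Finite ℤ_[p] (RestrictScalars ℤ_[p] (IwasawaAlgebra p) D.X) := by
  have hpr : p.Prime := Fact.out
  haveI : NeZero p := ⟨hpr.ne_zero⟩
  haveI : Finite ↥(W.geomTorsion (p : ℤ)) := W.finite_geomTorsion_nat hpr.ne_zero
  haveI : ContinuousSMul (absoluteGaloisGroup K) ↥(W.geomTorsion (p : ℤ)) :=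
    WeierstrassCurve.continuousSMul_geomTorsion W (WeierstrassCurve.isOpen_stabilizer_point_holds W) (p : ℤ)
  haveI : FiniteDimensional K ↥(fixedField (MulAction.stabilizer (absoluteGaloisGroup K) P) :
      IntermediateField K (AlgebraicClosure K)) :=
    finiteDimensional_fixedField_of_isOpen _ (stabilizer_isOpen (absoluteGaloisGroup K) P)
  haveI : NumberField ↥(fixedField (MulAction.stabilizer (absoluteGaloisGroup K) P) :
      IntermediateField K (AlgebraicClosure K)) := NumberField.of_module_finite K _
  exact conjA_of_classicalMuVanishes_stabilizerField W hp hirr hG P hP0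
    (fun κP hκP => classicalMuVanishes_of_classGroupPRank_succ_eq' κP (hram κP hκP) (Nat.zero_le n) (hrk κP hκP))
    κ hκ

end Literature.NumberTheory.EllipticCurves.CoatesSujatha2005

end
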